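import Summits.BirchSwinnertonDyer.BirchSwinnertonDyer.Theorems.ManinLocalTwoThreeBlindResidualEdges
import HarnessLib

/-!
# The non-blind half BY NAME: `RbNonBlind ⟸ E-an-48 ∧ E-an-53`, and `ManinOddOfReducibleAtFour ⟸ RbReducible`

Summit `BirchSwinnertonDyer`, route `ManinLocalTwoThree` (cell bsd-f2-manin), crux C2 `ManinOddAtFour` (stmt-BirchSwinnertonDyer-22967),
line `kato_shift_two`.  Completes the by-name web between an g16's `ShimuraLedger` (`RbReducible = RbNonBlind ∪ RbTotallyBlind`,
typer p623346) and the crux: 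

* `rbNonBlind_of_cuspidalKummer : CuspidalKummerRepresentativeAtFour → CuspidalKummerOddExponent → RbNonBlind` (E-an-52 by p2's
  theorem; the non-blind rational root is an integer on a globally minimal `a₁ = a₃ = 0` equation);
* `maninOddOfReducibleAtFour_of_rbReducible : RbReducible → ManinOddOfReducibleAtFour` (the lead's model glue p620514: additive at
  `2` ⇒ `a₁ = a₃ = 0` globally minimal companion with the transported datum; `W[2]` reducible ⇒ a rational 2-torsion abscissa);
* hence `maninOddOfReducibleAtFour_of_cuspidalKummer_of_rbTotallyBlind : E-an-48 → E-an-53 → RbTotallyBlind → ManinOddOfReducibleAtFour`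
  and the C2 corollary with F♯.

CONDITIONAL edges; nothing about BSD or Manin's conjecture is proved. [folklore]
-/

set_option autoImplicit false
set_option linter.dupNamespace false

noncomputable section

open scoped Classical MatrixGroups ModularForm
open PowerSeries CongruenceSubgroup
open WeierstrassCurve Literature.NumberTheory.EllipticCurves Literature.NumberTheory.EllipticCurves.ModularForms
open Summit.BirchSwinnertonDyer.Rank1Residual.ManinAdditive
open Summit.BirchSwinnertonDyer.Rank1Residual.ManinAdditive.CuspidalKummer
open Summit.BirchSwinnertonDyer.Rank1Residual.ManinAdditive.ShimuraLedger

namespace Summit.BirchSwinnertonDyer.BirchSwinnertonDyer.Theorems.ManinLocalTwoThree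

/-- **`RbNonBlind ⟸ K_geo ∧ E-an-53`** (E-an-52 is p2's theorem `ManinOddOfOddEtaExponent_holds`): on a globally minimal
`a₁ = a₃ = 0` equation a non-blind rational 2-torsion abscissa is an integer `e` with `¬ KummerBlindAtTwo a₂ a₄ e`; K_geo gives a
cuspidal Kummer representative, E-an-53 an odd exponent, E-an-52 an odd Manin constant. [folklore] -/
theorem rbNonBlind_of_cuspidalKummer (h48 : CuspidalKummerRepresentativeAtFour) (h53 : CuspidalKummerOddExponent) :
    RbNonBlind := by
  intro W _ _ N _ D hopt h4 hW₁ hW₃ hnb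
  have h4' : 4 ∣ N := by norm_num at h4; exact h4
  set M : WeierstrassCurve ℤ := integralModelInt W with hM
  have hWM : M.map (Int.castRingHom ℚ) = W := map_integralModelInt W
  have hM1 : M.a₁ = 0 := by
    have h := hW₁; rw [← hWM, map_a₁, eq_intCast] at h; exact_mod_cast h
  have hM3 : M.a₃ = 0 := by
    have h := hW₃; rw [← hWM, map_a₃, eq_intCast] at h; exact_mod_cast h
  have hW₂ : W.a₂ = (M.a₂ : ℚ) := by rw [← hWM, map_a₂, eq_intCast]
  have hW₄ : W.a₄ = (M.a₄ : ℚ) := by rw [← hWM, map_a₄, eq_intCast]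
  obtain ⟨e, he, hne⟩ := hnb
  have he' : W.twoTorsionPolynomial.toPoly.IsRoot e := (isRoot_twoTorsionPolynomial_iff_of_a₁_a₃ W hW₁ hW₃ e).mpr he
  have heM : (M.map (Int.castRingHom ℚ)).twoTorsionPolynomial.toPoly.IsRoot e := by rw [hWM]; exact he'
  obtain ⟨E, rfl⟩ := exists_intCast_eq_of_isRoot_twoTorsionPolynomial M hM1 hM3 heM
  have hnbE : ¬ KummerBlindAtTwo M.a₂ M.a₄ E := hne M.a₂ M.a₄ E hW₂.symm hW₄.symm rfl
  set a : ℕ → ℤ := fun n => W.LFunction n with ha_def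
  have ha : ∀ n, (a n : ℂ) = cuspCoeff D.f n := fun n => (D.isNewformOf.2 n).symm
  obtain ⟨z, hz⟩ := exists_isParamGerm W D.c a
  obtain ⟨r, g, A, B, hrep⟩ := h48 W D a ha h4' hopt (E : ℚ) he' z hz
  have hodd : ∃ δ ∈ N.divisors, Odd (r δ) :=
    h53 W D a ha h4' hopt M.a₂ M.a₄ E hW₁ hW₃ hW₂ hW₄ he' hnbE z hz r g A B hrep
  exact ManinOddOfOddEtaExponent_holds W D a ha h4' (E : ℚ) he' z hz r g A B hrep hodd

/-- **`ManinOddOfReducibleAtFour ⟸ RbReducible`** (an g16's `Rb(2)` on `a₁ = a₃ = 0` equations implies the unrestricted reducible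
residual): additive at `2` (`4 ∣ N ⇒ a₂(f) = 0 ∧ 2 ∣ N_W`), pass to the globally minimal `a₁ = a₃ = 0` companion `C • W` with the
transported datum (same `c`, lattice clause), and read `W[2]` reducible as a rational root of `x³ + a₂x² + a₄x + a₆`. [folklore] -/
theorem maninOddOfReducibleAtFour_of_rbReducible (hRb : RbReducible) : ManinOddOfReducibleAtFour := by
  intro W _ _ N _ D hopt h4 hred
  have h4' : 4 ∣ N := by norm_num at h4; exact h4
  obtain ⟨h2, hN2⟩ := lFunction_two_eq_zero_of_four_dvd W D.isNewformOf h4'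
  have hadd := hasAdditiveReductionAt_two_of_lFunction_two_eq_zero W h2 hN2
  obtain ⟨C, M, hu, hCW, hM1, hM3, hmin⟩ := exists_smul_eq_map_a₁_a₃_eq_zero_of_hasAdditiveReductionAt_two W hadd
  haveI := hmin
  obtain ⟨D', hf, hc, hL, -⟩ := exists_modularParametrizationData_smul_of_u_eq_one W D C hu
  have hopt' : ∀ z ∈ D'.L.lattice, ∃ w ∈ periodLattice D'.f, z = D'.c * w := by
    rw [hL, hf, hc]; exact hopt
  have ha₁ : (C • W).a₁ = 0 := by rw [hCW, map_a₁, hM1, map_zero]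
  have ha₃ : (C • W).a₃ = 0 := by rw [hCW, map_a₃, hM3, map_zero]
  have hred' : ¬ (C • W).HasIrreducibleModPGaloisRep 2 := by
    rwa [Mazur1978.hasIrreducibleModPGaloisRep_smul_iff]
  obtain ⟨e, he⟩ := exists_isRoot_twoTorsionPolynomial_of_not_hasIrreducibleModPGaloisRep_two (C • W) hred'
  have hT : HasRationalTwoTorsion (C • W) :=
    ⟨e, (isRoot_twoTorsionPolynomial_iff_of_a₁_a₃ (C • W) ha₁ ha₃ e).mp he⟩
  have h := hRb (C • W) D' hopt' h4 ha₁ ha₃ hT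
  change ¬ (2 : ℤ) ∣ D'.c at h
  rwa [hc] at h

/-- **`ManinOddOfReducibleAtFour ⟸ E-an-48 ∧ E-an-53 ∧ RbTotallyBlind`** — an g16's split `rbReducible_of_split`, by name.
CONDITIONAL. [folklore] -/
theorem maninOddOfReducibleAtFour_of_cuspidalKummer_of_rbTotallyBlind (h48 : CuspidalKummerRepresentativeAtFour)
    (h53 : CuspidalKummerOddExponent) (hb : RbTotallyBlind) : ManinOddOfReducibleAtFour :=
  maninOddOfReducibleAtFour_of_rbReducible (rbReducible_of_split (rbNonBlind_of_cuspidalKummer h48 h53) hb)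

/-- **C2 BY NAME from F♯, K_geo, E-an-53 and an g16's `RbTotallyBlind`** (equivalently `RbTotallyBlindTame ∧ RbTotallyBlindWild`).
CONDITIONAL. [cite: Kato2004Asterisque, Thm. 9.7 (p. 189)] -/
theorem maninOddAtFour_of_katoFact_of_cuspidalKummer_of_rbTotallyBlind
    (hF : kato_neron_isIntegral_twistedSymbolSum_of_additive_two_real)
    (h48 : CuspidalKummerRepresentativeAtFour) (h53 : CuspidalKummerOddExponent) (hb : RbTotallyBlind) :
    Summit.BirchSwinnertonDyer.BirchSwinnertonDyer.Theses.ManinLocalTwoThree.ManinOddAtFour :=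
  maninOddAtFour_of_katoFact_of_reducible hF (maninOddOfReducibleAtFour_of_cuspidalKummer_of_rbTotallyBlind h48 h53 hb)

end Summit.BirchSwinnertonDyer.BirchSwinnertonDyer.Theorems.ManinLocalTwoThree

end
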